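import Mathlib

/-!
# Route `FilamentSkeletonRss` · child crux `TangentSkeletonNearStraightL` (stmt-NavierStokesRegularity-23320) · registered line
# `child_tangent_analytic_strip_L` (b0b56c52900dd90a), stub `stub_stripPropagation` — brick: THE COMPLEXIFIED CHORD AT SECOND ORDER (variance form)

The landed near-diagonal bricks (`Theorems.StadiumChord`, `Theorems.StadiumChordComplex`, `Theorems.StadiumSegmentPositivity`,
`Theorems.StadiumNearPositivity`) control the complexified squared chord `Q(z, s) = Σᵢ (Fᵢ(z+s) − Fᵢ(z))²` of a stadium-analytic filament `F`
through a TANGENT-DEVIATION hypothesis `‖F′ − t̄‖ ≤ η` along the segment (`‖Q − s²‖ ≤ 6η²‖s‖²`, principal branch iff `6η² < 1`), and that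
deviation is what the two-constants estimate cannot supply on the registered quarter-width stadium near its ends (census of hands
leafhand-2-g2 / 7-g0 / 9-g0 on the item).  This file uses the one input those bricks leave at first order — the quadric structure
`Σᵢ (F′)ᵢ² ≡ 1` (`Theorems.StadiumBilinearUnitSpeed`) — at SECOND order:

* `sum_mul_sub_one_eq` — polarisation on the quadric: `Σ aᵢ² = Σ bᵢ² = 1 ⇒ Σ aᵢbᵢ − 1 = −½ Σ (aᵢ − bᵢ)²`;
* `chord_sq_sub_sq_norm_le_of_lipschitz` — VARIANCE FORM: if `F′` is `K`-Lipschitz in the parameter `r ∈ [0,1]` along the complex segment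
  `z + r·s`, then `‖Q(z,s) − s²‖ ≤ (K²/4)·‖s‖²` (double mean `Σ Wᵢ² − 1 = ∫₀¹∫₀¹ (Σᵢ aᵢ(r)aᵢ(r′) − 1)`, pointwise `≤ (3/2)K²(r−r′)²`,
  `∫₀¹∫₀¹ (r−r′)² = 1/6`);
* `chord_sq_sub_sq_norm_le_of_deriv_deriv` — with a second-derivative bound `‖F″‖ ≤ M` on the segment: `‖Q(z,s) − s²‖ ≤ (M²/4)·‖s‖⁴`,
  the complex analogue of the real chord expansion `|X(τ)−X(σ)|² = s²(1 − κ²s²/12 + …)`; NO deviation hypothesis, any direction `s ∈ ℂ`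
  (in the deviation form this is `6M²‖s‖⁴`, i.e. the constant improves by `24`);
* `sq_re_ge_of_abs_im_le`, `re_chord_add_core_pos_of_deriv_deriv` — the principal-branch condition for the matched kernel in the DOUBLE CONE
  `|Im s| ≤ λ|Re s|`: `Re(Q + κ·G) > 0` as soon as `(M²/4)‖s‖² · (1+λ²) ≤ 1 − λ²` — the near-diagonal input of a target-dependent DESCENDING
  (tent) contour, which a proof at the registered quarter width would have to use instead of the full-height plateau of
  `Theorems.StadiumStripCore.strip_core` (hypothesis `16h ≤ hs`);
* `chord_sq_sub_sq_norm_le_of_deriv_deriv_real` — the horizontal specialisation in the conventions of `Theorems.StadiumChord`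
  (`z + r`, `r ∈ uIcc 0 s`).

HONEST FRAMING: elementary bricks for a plan about a HYPOTHETICAL filament skeleton on the NEGATIVE side of a MODEL route; the stub
`stub_stripPropagation` is NOT closed by this file; nothing here bears on Navier–Stokes regularity or blow-up.
`--supports stmt-NavierStokesRegularity-23320`.
-/

set_option linter.dupNamespace false

noncomputable section

namespace Summit.NavierStokesRegularity.NavierStokesRegularity.Theorems.StadiumChordVariance

open Set MeasureTheory
open scoped BigOperators

/-! ## Polarisation on the quadric `Σ vᵢ² = 1` -/

/-- **Polarisation on the quadric.**  For `a b : ℂ³` with `Σ aᵢ² = Σ bᵢ² = 1`: `Σ aᵢbᵢ − 1 = −½·Σ (aᵢ − bᵢ)²`. [folklore] -/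
theorem sum_mul_sub_one_eq (a b : Fin 3 → ℂ) (ha : ∑ i, a i ^ 2 = 1) (hb : ∑ i, b i ^ 2 = 1) :
    ∑ i, a i * b i - 1 = -(1 / 2 : ℂ) * ∑ i, (a i - b i) ^ 2 := by
  simp only [Fin.sum_univ_three] at ha hb ⊢
  linear_combination (1 / 2 : ℂ) * ha + (1 / 2 : ℂ) * hb

/-- **Norm form of the polarisation.**  `‖Σ aᵢbᵢ − 1‖ ≤ (3/2)·‖a − b‖²` (sup norm on `ℂ³`). [folklore] -/
theorem norm_sum_mul_sub_one_le (a b : Fin 3 → ℂ) (ha : ∑ i, a i ^ 2 = 1) (hb : ∑ i, b i ^ 2 = 1) :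
    ‖∑ i, a i * b i - 1‖ ≤ (3 / 2 : ℝ) * ‖a - b‖ ^ 2 := by
  rw [sum_mul_sub_one_eq a b ha hb, norm_mul, norm_neg]
  have h1 : ‖∑ i, (a i - b i) ^ 2‖ ≤ 3 * ‖a - b‖ ^ 2 := by
    calc ‖∑ i, (a i - b i) ^ 2‖ ≤ ∑ i, ‖(a i - b i) ^ 2‖ := norm_sum_le _ _
      _ ≤ ∑ _i : Fin 3, ‖a - b‖ ^ 2 := Finset.sum_le_sum fun i _ => by
          rw [norm_pow]
          exact pow_le_pow_left₀ (norm_nonneg _) (by simpa using norm_le_pi_norm (a - b) i) 2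
      _ = 3 * ‖a - b‖ ^ 2 := by simp
  have h2 : ‖(1 / 2 : ℂ)‖ = 1 / 2 := by
    rw [show (1 / 2 : ℂ) = ((1 / 2 : ℝ) : ℂ) by push_cast; ring, Complex.norm_real, Real.norm_eq_abs]
    norm_num
  rw [h2]
  linarith

/-! ## The variance form of the complexified chord -/

/-- **Complexified chord, variance form.**  `F : ℂ → ℂ³` complex-differentiable on an open `U` with `Σᵢ (F′(w))ᵢ² = 1` on `U`; if the
segment `{z + r·s : r ∈ [0,1]}` lies in `U` and `F′` is `K`-Lipschitz in the parameter along it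
(`‖F′(z + r·s) − F′(z + r′·s)‖ ≤ K·|r − r′|`), then `‖Σᵢ (Fᵢ(z+s) − Fᵢ(z))² − s²‖ ≤ (K²/4)·‖s‖²`. [folklore] -/
theorem chord_sq_sub_sq_norm_le_of_lipschitz {U : Set ℂ} (hU : IsOpen U) {F : ℂ → (Fin 3 → ℂ)} (hF : DifferentiableOn ℂ F U)
    (hunit : ∀ w ∈ U, ∑ i, (deriv F w i) ^ 2 = 1) {z s : ℂ} {K : ℝ}
    (hseg : ∀ r ∈ Set.Icc (0:ℝ) 1, z + (r : ℂ) * s ∈ U)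
    (hK : ∀ r ∈ Set.Icc (0:ℝ) 1, ∀ r' ∈ Set.Icc (0:ℝ) 1,
      ‖deriv F (z + (r : ℂ) * s) - deriv F (z + (r' : ℂ) * s)‖ ≤ K * |r - r'|) :
    ‖(∑ i, (F (z + s) i - F z i) ^ 2) - s ^ 2‖ ≤ K ^ 2 / 4 * ‖s‖ ^ 2 := by
  have hIcc : Set.uIcc (0:ℝ) 1 = Set.Icc 0 1 := uIcc_of_le zero_le_one
  set a : ℝ → (Fin 3 → ℂ) := fun r => deriv F (z + (r : ℂ) * s) with ha
  -- continuity along the segment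
  have hdcont : ContinuousOn (deriv F) U := ((hF.analyticOnNhd hU).deriv).continuousOn
  have hpath_cont : Continuous fun r : ℝ => z + (r : ℂ) * s :=
    continuous_const.add (Complex.continuous_ofReal.mul continuous_const)
  have ha_cont : ContinuousOn a (uIcc 0 1) := by
    rw [hIcc]; exact hdcont.comp hpath_cont.continuousOn fun r hr => hseg r hr
  have hai_cont : ∀ i, ContinuousOn (fun r => a r i) (uIcc 0 1) := fun i =>
    (continuous_apply i).comp_continuousOn ha_cont
  -- derivative of the path `r ↦ F(z + r s)` is `s • a r`, and the fundamental theorem of calculus coordinatewise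
  have hderiv : ∀ r ∈ uIcc (0:ℝ) 1, HasDerivAt (fun r : ℝ => F (z + (r : ℂ) * s)) (s • a r) r := by
    intro r hr
    rw [hIcc] at hr
    have hFd : HasDerivAt F (deriv F (z + (r : ℂ) * s)) (z + (r : ℂ) * s) :=
      (hF.differentiableAt (hU.mem_nhds (hseg r hr))).hasDerivAt
    have hp : HasDerivAt (fun r : ℝ => z + (r : ℂ) * s) s r := by
      have h1 := (((hasDerivAt_id r).ofReal_comp).mul_const s).const_add z
      simpa using h1
    exact hFd.scomp r hp
  set W : Fin 3 → ℂ := fun i => ∫ r in (0:ℝ)..1, a r i with hW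
  have hFTC : ∀ i, F (z + s) i - F z i = s * W i := by
    intro i
    have hci : ∀ r ∈ uIcc (0:ℝ) 1, HasDerivAt (fun r : ℝ => F (z + (r : ℂ) * s) i) (s * a r i) r := by
      intro r hr
      have h := (hasDerivAt_pi.1 (hderiv r hr)) i
      simpa [Pi.smul_apply, smul_eq_mul] using h
    have hint : IntervalIntegrable (fun r => s * a r i) MeasureTheory.volume 0 1 :=
      ((hai_cont i).intervalIntegrable).const_mul s
    have h := intervalIntegral.integral_eq_sub_of_hasDerivAt hci hint
    rw [intervalIntegral.integral_const_mul] at h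
    rw [hW]
    simp only at h ⊢
    rw [h]; simp
  -- `Q − s² = s²·(Σ Wᵢ² − 1)`
  have hsum : (∑ i, (F (z + s) i - F z i) ^ 2) - s ^ 2 = s ^ 2 * (∑ i, W i ^ 2 - 1) := by
    simp only [Fin.sum_univ_three, hFTC]
    ring
  -- the inner mean: `Σᵢ aᵢ(r)·Wᵢ − 1 = ∫₀¹ (Σᵢ aᵢ(r) aᵢ(r′) − 1) dr′`
  have hinner_int : ∀ r, IntervalIntegrable (fun r' => ∑ i, a r i * a r' i) volume (0:ℝ) 1 := fun r =>
    (continuousOn_finsetSum _ fun i _ => (continuousOn_const.mul (hai_cont i))).intervalIntegrable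
  have hinner_eq : ∀ r, ∑ i, a r i * W i - 1 = ∫ r' in (0:ℝ)..1, (∑ i, a r i * a r' i - 1) := by
    intro r
    rw [intervalIntegral.integral_sub (hinner_int r) intervalIntegrable_const, intervalIntegral.integral_const]
    simp only [sub_zero, one_smul]
    congr 1
    rw [intervalIntegral.integral_finsetSum fun i _ => ((hai_cont i).intervalIntegrable.const_mul (a r i))]
    refine Finset.sum_congr rfl fun i _ => ?_
    exact (intervalIntegral.integral_const_mul (a r i) _).symm
  -- the outer mean: `Σ Wᵢ² − 1 = ∫₀¹ (Σᵢ aᵢ(r)·Wᵢ − 1) dr`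
  have houter_int : IntervalIntegrable (fun r => ∑ i, a r i * W i) volume (0:ℝ) 1 :=
    (continuousOn_finsetSum _ fun i _ => ((hai_cont i).mul continuousOn_const)).intervalIntegrable
  have houter_eq : ∑ i, W i ^ 2 - 1 = ∫ r in (0:ℝ)..1, (∑ i, a r i * W i - 1) := by
    rw [intervalIntegral.integral_sub houter_int intervalIntegrable_const, intervalIntegral.integral_const]
    simp only [sub_zero, one_smul]
    congr 1
    rw [intervalIntegral.integral_finsetSum fun i _ => ((hai_cont i).intervalIntegrable.mul_const (W i))]
    refine Finset.sum_congr rfl fun i _ => ?_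
    rw [sq]
    exact (intervalIntegral.integral_mul_const (W i) _).symm
  -- pointwise polarisation bound for each pair of parameters
  have hpair : ∀ r ∈ Icc (0:ℝ) 1, ∀ r' ∈ Icc (0:ℝ) 1,
      ‖∑ i, a r i * a r' i - 1‖ ≤ (3 / 2 : ℝ) * K ^ 2 * (r - r') ^ 2 := by
    intro r hr r' hr'
    have hu : ∑ i, (a r i) ^ 2 = 1 := hunit _ (hseg r hr)
    have hu' : ∑ i, (a r' i) ^ 2 = 1 := hunit _ (hseg r' hr')
    have h1 := norm_sum_mul_sub_one_le (a r) (a r') hu hu'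
    have h2 : ‖a r - a r'‖ ≤ K * |r - r'| := hK r hr r' hr'
    have h3 : ‖a r - a r'‖ ^ 2 ≤ (K * |r - r'|) ^ 2 := pow_le_pow_left₀ (norm_nonneg _) h2 2
    have h4 : (K * |r - r'|) ^ 2 = K ^ 2 * (r - r') ^ 2 := by rw [mul_pow, sq_abs]
    calc ‖∑ i, a r i * a r' i - 1‖ ≤ (3 / 2 : ℝ) * ‖a r - a r'‖ ^ 2 := h1
      _ ≤ (3 / 2 : ℝ) * (K ^ 2 * (r - r') ^ 2) := by
          rw [← h4]; exact mul_le_mul_of_nonneg_left h3 (by norm_num)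
      _ = (3 / 2 : ℝ) * K ^ 2 * (r - r') ^ 2 := by ring
  -- the inner integral of the bound: `∫₀¹ (r − r′)² dr′ = r² − r + 1/3`
  have hinner_val : ∀ r : ℝ, ∫ r' in (0:ℝ)..1, (3 / 2 : ℝ) * K ^ 2 * (r - r') ^ 2 =
      (3 / 2 : ℝ) * K ^ 2 * (r ^ 2 - r + 1 / 3) := by
    intro r
    rw [intervalIntegral.integral_const_mul]
    congr 1
    rw [intervalIntegral.integral_comp_sub_left (fun x : ℝ => x ^ 2) r, integral_pow]
    norm_num
    ring
  have hinner_bd : ∀ r ∈ Icc (0:ℝ) 1, ‖∑ i, a r i * W i - 1‖ ≤ (3 / 2 : ℝ) * K ^ 2 * (r ^ 2 - r + 1 / 3) := by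
    intro r hr
    rw [hinner_eq r]
    have hb : ∀ᵐ r' ∂volume, r' ∈ Set.Ioc (0:ℝ) 1 →
        ‖∑ i, a r i * a r' i - 1‖ ≤ (3 / 2 : ℝ) * K ^ 2 * (r - r') ^ 2 :=
      Filter.Eventually.of_forall fun r' hr' => hpair r hr r' (Ioc_subset_Icc_self hr')
    have hgi : IntervalIntegrable (fun r' : ℝ => (3 / 2 : ℝ) * K ^ 2 * (r - r') ^ 2) volume (0:ℝ) 1 :=
      (by fun_prop : Continuous fun r' : ℝ => (3 / 2 : ℝ) * K ^ 2 * (r - r') ^ 2).intervalIntegrable _ _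
    have h := intervalIntegral.norm_integral_le_of_norm_le zero_le_one hb hgi
    rwa [hinner_val r] at h
  -- the outer integral of the bound: `∫₀¹ (r² − r + 1/3) dr = 1/6`
  have houter_val : ∫ r in (0:ℝ)..1, (3 / 2 : ℝ) * K ^ 2 * (r ^ 2 - r + 1 / 3) = K ^ 2 / 4 := by
    rw [intervalIntegral.integral_const_mul,
      intervalIntegral.integral_add ((by fun_prop : Continuous fun r : ℝ => r ^ 2 - r).intervalIntegrable _ _)
        intervalIntegrable_const,
      intervalIntegral.integral_sub ((by fun_prop : Continuous fun r : ℝ => r ^ 2).intervalIntegrable _ _)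
        ((by fun_prop : Continuous fun r : ℝ => r).intervalIntegrable _ _),
      integral_pow, integral_id, intervalIntegral.integral_const]
    norm_num
    ring
  have houter_bd : ‖∑ i, W i ^ 2 - 1‖ ≤ K ^ 2 / 4 := by
    rw [houter_eq]
    have hb : ∀ᵐ r ∂volume, r ∈ Set.Ioc (0:ℝ) 1 →
        ‖∑ i, a r i * W i - 1‖ ≤ (3 / 2 : ℝ) * K ^ 2 * (r ^ 2 - r + 1 / 3) :=
      Filter.Eventually.of_forall fun r hr => hinner_bd r (Ioc_subset_Icc_self hr)
    have hgi : IntervalIntegrable (fun r : ℝ => (3 / 2 : ℝ) * K ^ 2 * (r ^ 2 - r + 1 / 3)) volume (0:ℝ) 1 :=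
      (by fun_prop : Continuous fun r : ℝ => (3 / 2 : ℝ) * K ^ 2 * (r ^ 2 - r + 1 / 3)).intervalIntegrable _ _
    have h := intervalIntegral.norm_integral_le_of_norm_le zero_le_one hb hgi
    rwa [houter_val] at h
  -- conclusion
  rw [hsum, norm_mul, norm_pow]
  calc ‖s‖ ^ 2 * ‖∑ i, W i ^ 2 - 1‖ ≤ ‖s‖ ^ 2 * (K ^ 2 / 4) :=
        mul_le_mul_of_nonneg_left houter_bd (by positivity)
    _ = K ^ 2 / 4 * ‖s‖ ^ 2 := by ring

/-- The complex segment `{z + r·s : r ∈ [0,1]}` is `segment ℝ z (z + s)`. [folklore] -/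
theorem segment_eq_image_mul (z s : ℂ) :
    segment ℝ z (z + s) = (fun r : ℝ => z + (r : ℂ) * s) '' Set.Icc (0:ℝ) 1 := by
  rw [segment_eq_image']
  refine Set.image_congr' fun θ => ?_
  simp only [add_sub_cancel_left, Complex.real_smul]

/-- **Complexified chord at second order.**  `F : ℂ → ℂ³` complex-differentiable on an open `U` with `Σᵢ (F′(w))ᵢ² = 1` on `U`; if the
segment `{z + r·s : r ∈ [0,1]}` lies in `U` and `‖F″‖ ≤ M` along it, then `‖Σᵢ (Fᵢ(z+s) − Fᵢ(z))² − s²‖ ≤ (M²/4)·‖s‖⁴` — no tangent-deviation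
hypothesis, any complex direction `s`. [folklore] -/
theorem chord_sq_sub_sq_norm_le_of_deriv_deriv {U : Set ℂ} (hU : IsOpen U) {F : ℂ → (Fin 3 → ℂ)} (hF : DifferentiableOn ℂ F U)
    (hunit : ∀ w ∈ U, ∑ i, (deriv F w i) ^ 2 = 1) {z s : ℂ} {M : ℝ}
    (hseg : ∀ r ∈ Set.Icc (0:ℝ) 1, z + (r : ℂ) * s ∈ U)
    (hM : ∀ r ∈ Set.Icc (0:ℝ) 1, ‖deriv (deriv F) (z + (r : ℂ) * s)‖ ≤ M) :
    ‖(∑ i, (F (z + s) i - F z i) ^ 2) - s ^ 2‖ ≤ M ^ 2 / 4 * ‖s‖ ^ 4 := by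
  have hseg_eq := segment_eq_image_mul z s
  have hdiff : ∀ x ∈ segment ℝ z (z + s), DifferentiableAt ℂ (deriv F) x := by
    intro x hx
    rw [hseg_eq] at hx
    obtain ⟨r, hr, rfl⟩ := hx
    exact ((hF.analyticOnNhd hU).deriv).differentiableOn.differentiableAt (hU.mem_nhds (hseg r hr))
  have hbound : ∀ x ∈ segment ℝ z (z + s), ‖deriv (deriv F) x‖ ≤ M := by
    intro x hx
    rw [hseg_eq] at hx
    obtain ⟨r, hr, rfl⟩ := hx
    exact hM r hr
  have hK : ∀ r ∈ Set.Icc (0:ℝ) 1, ∀ r' ∈ Set.Icc (0:ℝ) 1,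
      ‖deriv F (z + (r : ℂ) * s) - deriv F (z + (r' : ℂ) * s)‖ ≤ (M * ‖s‖) * |r - r'| := by
    intro r hr r' hr'
    have hx : z + (r' : ℂ) * s ∈ segment ℝ z (z + s) := by rw [hseg_eq]; exact ⟨r', hr', rfl⟩
    have hy : z + (r : ℂ) * s ∈ segment ℝ z (z + s) := by rw [hseg_eq]; exact ⟨r, hr, rfl⟩
    have h := (convex_segment z (z + s)).norm_image_sub_le_of_norm_deriv_le hdiff hbound hx hy
    have e : ‖(z + (r : ℂ) * s) - (z + (r' : ℂ) * s)‖ = |r - r'| * ‖s‖ := by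
      rw [show (z + (r : ℂ) * s) - (z + (r' : ℂ) * s) = ((r - r' : ℝ) : ℂ) * s by push_cast; ring,
        norm_mul, Complex.norm_real, Real.norm_eq_abs]
    rw [e] at h
    calc ‖deriv F (z + (r : ℂ) * s) - deriv F (z + (r' : ℂ) * s)‖ ≤ M * (|r - r'| * ‖s‖) := h
      _ = M * ‖s‖ * |r - r'| := by ring
  have h := chord_sq_sub_sq_norm_le_of_lipschitz hU hF hunit hseg hK
  calc ‖(∑ i, (F (z + s) i - F z i) ^ 2) - s ^ 2‖ ≤ (M * ‖s‖) ^ 2 / 4 * ‖s‖ ^ 2 := h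
    _ = M ^ 2 / 4 * ‖s‖ ^ 4 := by ring

/-- **Real part of the chord at second order.**  Under the hypotheses of `chord_sq_sub_sq_norm_le_of_deriv_deriv`:
`Re(s²) − (M²/4)‖s‖⁴ ≤ Re Σᵢ (Fᵢ(z+s) − Fᵢ(z))²`. [folklore] -/
theorem chord_sq_re_ge_of_deriv_deriv {U : Set ℂ} (hU : IsOpen U) {F : ℂ → (Fin 3 → ℂ)} (hF : DifferentiableOn ℂ F U)
    (hunit : ∀ w ∈ U, ∑ i, (deriv F w i) ^ 2 = 1) {z s : ℂ} {M : ℝ}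
    (hseg : ∀ r ∈ Set.Icc (0:ℝ) 1, z + (r : ℂ) * s ∈ U)
    (hM : ∀ r ∈ Set.Icc (0:ℝ) 1, ‖deriv (deriv F) (z + (r : ℂ) * s)‖ ≤ M) :
    (s ^ 2).re - M ^ 2 / 4 * ‖s‖ ^ 4 ≤ (∑ i, (F (z + s) i - F z i) ^ 2).re := by
  have h := chord_sq_sub_sq_norm_le_of_deriv_deriv hU hF hunit hseg hM
  set Q : ℂ := ∑ i, (F (z + s) i - F z i) ^ 2 with hQ
  have hre : Q.re = (s ^ 2).re + (Q - s ^ 2).re := by simp [Complex.sub_re]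
  have hlow : -(M ^ 2 / 4 * ‖s‖ ^ 4) ≤ (Q - s ^ 2).re := by
    have h1 := Complex.abs_re_le_norm (Q - s ^ 2)
    have h2 := neg_abs_le (Q - s ^ 2).re
    linarith
  rw [hre]
  linarith

/-! ## The double cone: principal branch for descending contours -/

/-- **Cone geometry.**  If `|Im s| ≤ λ·|Re s|`, then `(1 − λ²)·‖s‖² ≤ (1 + λ²)·Re(s²)`. [folklore] -/
theorem sq_re_ge_of_abs_im_le {s : ℂ} {lam : ℝ} (hs : |s.im| ≤ lam * |s.re|) :
    (1 - lam ^ 2) * ‖s‖ ^ 2 ≤ (1 + lam ^ 2) * (s ^ 2).re := by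
  have h1 : s.im ^ 2 ≤ lam ^ 2 * s.re ^ 2 := by
    have h := mul_self_le_mul_self (abs_nonneg _) hs
    rw [← sq, ← sq, sq_abs, mul_pow, sq_abs] at h
    exact h
  have hn : ‖s‖ ^ 2 = s.re ^ 2 + s.im ^ 2 := by
    rw [Complex.sq_norm, Complex.normSq_apply]; ring
  have hr : (s ^ 2).re = s.re ^ 2 - s.im ^ 2 := by
    rw [sq, Complex.mul_re]; ring
  rw [hn, hr]
  nlinarith [sq_nonneg s.re, sq_nonneg s.im, sq_nonneg lam]

/-- **Principal branch in the double cone, with the core term.**  `F : ℂ → ℂ³` complex-differentiable on an open `U` with `Σᵢ (F′)ᵢ² = 1`,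
the segment `z + [0,1]·s ⊆ U`, `‖F″‖ ≤ M` along it, a displacement in the double cone `|Im s| ≤ λ|Re s|` (`λ < 1`) short enough that
`(M²/4)‖s‖²·(1+λ²) ≤ 1 − λ²`, a core real part `g₀ ≤ Re Gv` with `0 < g₀`, `0 < κ`: then
`0 < Re(Σᵢ (Fᵢ(z+s) − Fᵢ(z))² + κ·Gv)` — the matched kernel is on its principal branch. [folklore] -/
theorem re_chord_add_core_pos_of_deriv_deriv {U : Set ℂ} (hU : IsOpen U) {F : ℂ → (Fin 3 → ℂ)} (hF : DifferentiableOn ℂ F U)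
    (hunit : ∀ w ∈ U, ∑ i, (deriv F w i) ^ 2 = 1) {z s : ℂ} {M lam κ g₀ : ℝ} {Gv : ℂ}
    (hseg : ∀ r ∈ Set.Icc (0:ℝ) 1, z + (r : ℂ) * s ∈ U)
    (hM : ∀ r ∈ Set.Icc (0:ℝ) 1, ‖deriv (deriv F) (z + (r : ℂ) * s)‖ ≤ M)
    (hcone : |s.im| ≤ lam * |s.re|)
    (hshort : M ^ 2 / 4 * ‖s‖ ^ 2 * (1 + lam ^ 2) ≤ 1 - lam ^ 2)
    (hκ : 0 < κ) (hg₀ : 0 < g₀) (hG : g₀ ≤ Gv.re) :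
    0 < ((∑ i, (F (z + s) i - F z i) ^ 2) + (κ : ℂ) * Gv).re := by
  have h1 := chord_sq_re_ge_of_deriv_deriv hU hF hunit hseg hM
  have h2 := sq_re_ge_of_abs_im_le hcone
  -- `(M²/4)‖s‖⁴ ≤ Re(s²)`: multiply `hshort` by `‖s‖²` and compare with the cone inequality
  have h3 : M ^ 2 / 4 * ‖s‖ ^ 4 ≤ (s ^ 2).re := by
    have hn0 : 0 ≤ ‖s‖ ^ 2 := by positivity
    have h4 : M ^ 2 / 4 * ‖s‖ ^ 4 * (1 + lam ^ 2) ≤ (1 - lam ^ 2) * ‖s‖ ^ 2 := by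
      have := mul_le_mul_of_nonneg_right hshort hn0
      calc M ^ 2 / 4 * ‖s‖ ^ 4 * (1 + lam ^ 2) = M ^ 2 / 4 * ‖s‖ ^ 2 * (1 + lam ^ 2) * ‖s‖ ^ 2 := by ring
        _ ≤ (1 - lam ^ 2) * ‖s‖ ^ 2 := this
    have h5 : M ^ 2 / 4 * ‖s‖ ^ 4 * (1 + lam ^ 2) ≤ (1 + lam ^ 2) * (s ^ 2).re := h4.trans h2
    have h6 : 0 < 1 + lam ^ 2 := by positivity
    nlinarith
  rw [Complex.add_re, Complex.re_ofReal_mul]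
  have h7 : κ * g₀ ≤ κ * Gv.re := mul_le_mul_of_nonneg_left hG hκ.le
  have h8 : 0 < κ * g₀ := mul_pos hκ hg₀
  linarith

/-! ## Horizontal specialisation (conventions of `Theorems.StadiumChord`) -/

/-- For `r' ∈ [0,1]` and any real `s`, `r'·s` lies between `0` and `s`. [folklore] -/
theorem mul_mem_uIcc_zero {r' s : ℝ} (hr' : r' ∈ Set.Icc (0:ℝ) 1) : r' * s ∈ Set.uIcc 0 s := by
  rcases le_or_gt 0 s with hs | hs
  · rw [uIcc_of_le hs]
    exact ⟨mul_nonneg hr'.1 hs, by nlinarith [hr'.2]⟩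
  · rw [uIcc_of_ge hs.le]
    exact ⟨by nlinarith [hr'.2], mul_nonpos_of_nonneg_of_nonpos hr'.1 hs.le⟩

/-- **Horizontal chord at second order.**  `F : ℂ → ℂ³` complex-differentiable on an open `U` with `Σᵢ (F′(w))ᵢ² = 1` on `U`; if the
horizontal segment `{z + r : r between 0 and s}` lies in `U` and `‖F″(z + r)‖ ≤ M` along it, then
`‖Σᵢ (Fᵢ(z+s) − Fᵢ(z))² − s²‖ ≤ (M²/4)·s⁴`. [folklore] -/
theorem chord_sq_sub_sq_norm_le_of_deriv_deriv_real {U : Set ℂ} (hU : IsOpen U) {F : ℂ → (Fin 3 → ℂ)}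
    (hF : DifferentiableOn ℂ F U) (hunit : ∀ w ∈ U, ∑ i, (deriv F w i) ^ 2 = 1) {z : ℂ} {s M : ℝ}
    (hseg : ∀ r ∈ Set.uIcc 0 s, z + (r : ℂ) ∈ U)
    (hM : ∀ r ∈ Set.uIcc 0 s, ‖deriv (deriv F) (z + (r : ℂ))‖ ≤ M) :
    ‖(∑ i, (F (z + (s : ℂ)) i - F z i) ^ 2) - (s : ℂ) ^ 2‖ ≤ M ^ 2 / 4 * s ^ 4 := by
  have e : ∀ r' : ℝ, z + (r' : ℂ) * (s : ℂ) = z + ((r' * s : ℝ) : ℂ) := fun r' => by push_cast; ring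
  have hseg' : ∀ r' ∈ Set.Icc (0:ℝ) 1, z + (r' : ℂ) * (s : ℂ) ∈ U := fun r' hr' => by
    rw [e r']; exact hseg _ (mul_mem_uIcc_zero hr')
  have hM' : ∀ r' ∈ Set.Icc (0:ℝ) 1, ‖deriv (deriv F) (z + (r' : ℂ) * (s : ℂ))‖ ≤ M := fun r' hr' => by
    rw [e r']; exact hM _ (mul_mem_uIcc_zero hr')
  have h := chord_sq_sub_sq_norm_le_of_deriv_deriv hU hF hunit hseg' hM'
  have hn : ‖(s : ℂ)‖ ^ 4 = s ^ 4 := by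
    rw [Complex.norm_real, Real.norm_eq_abs]
    have : (4:ℕ) = 2 * 2 := by norm_num
    rw [this, pow_mul, sq_abs, ← pow_mul]
  rw [hn] at h
  exact h

end Summit.NavierStokesRegularity.NavierStokesRegularity.Theorems.StadiumChordVariance

end
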